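import Mathlib
import HarnessLib
import Summits.Ventures.LatticeQCDFlow.Exactness.SpectralKernelJacobianWeylShapeSU
import Summits.Ventures.LatticeQCDFlow.Exactness.SpectralKernelJacobianWeylShape

/-!
# End to end: the `SU(N)` / `U(N)` spectral coupling layer is an exact transport of product Haar with the engine's booked log-det — modulo exactly Weyl's integral formula and the box flow's torus Jacobians

HONEST FRAMING: exact (Metropolis-corrected) sampling algorithms for lattice gauge theory;
figures of merit are autocorrelation/cost numbers at stated couplings and volumes; no
continuum-physics claim.

Venture `LatticeQCDFlow` (cell pub-lqcd), topic `Exactness`; FANOUT row 10 (`eng-equiv`, engine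
`latflow.equiv`, `spectral.SUNSpectralCoupling` + `masks.py` + `flow.py` "exact accumulated
log-det"; `latflow.flows_jax.sun_flow` / `scan_flow`).  NEW WORK of the cell: the ASSEMBLY of
`SpectralCouplingMeasurable.lean` (the layer is exact given the kernel's own Jacobian) with
`SpectralKernelJacobianWeylShape[SU].lean` (the kernel's Jacobian given a conjugation presentation
of Haar); nothing is cited as a fact; no number; no definition is introduced.  Printed
counterparts, NAMED ONLY: Boyda et al., PRD 103 (2021) 074504 (the `SU(N)` layer and its
density, eqs. (10), (19)); Bröcker–tom Dieck IV (1.11) (Weyl's integral formula — entering as the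
HYPOTHESIS `hW`).

## What is typed

For a finite link set `ι` with mask `p`, per active link `a` and frozen context `y`: a staple
`S a y` (continuous in `y`), an eigenvalue map `f a y` (jointly continuous on context × torus), a
kernel `h a y` following its spectral recipe, a torus map `fT a y : SΔ(n) → SΔ(n)`
(`diag d ↦ diag(f a y d)`) with Jacobian `JfT a y` for `Haar_{SΔ(n)}` (the box flow's own
certificate), and a booked density `j a y ≥ 0` (jointly continuous) satisfying Boyda's identity
`j a y (g t g⁻¹) · |Δ(t)|²/n! = JfT a y t · |Δ(fT a y t)|²/n!`.

* **`hasJacobian_spectralCouplingLayer_of_weyl_specialUnitary`** — IF conjugation presents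
  `Haar_{SU(n)}` from `Haar_{SU(n)} ⊗ (|Δ|²/n!)·Haar_{SΔ(n)}` (Weyl's formula for `SU(n)`,
  hypothesis `hW`), THEN the spectral coupling layer
  `Theory2.coupleFun p (u_a ↦ h a y (u_a S) (u_a S)⁻¹ u_a)` has
  `HasJacobian (⊗_ι Haar_{SU(n)}) _ (Theory2.coupleJac p (j at the loops))`: it is an exact
  transport of product Haar with exactly the density the engine books (sum over active links of
  the kernel log-dets at the loops);
* **`hasJacobian_spectralCouplingLayer_of_weyl_unitary`** — the `U(n)` twin with `Δ(n)`.

NOT here (the two named inputs): Weyl's integral formula; the box flow's torus Jacobian; any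
number.
-/

noncomputable section

namespace Summit.Ventures.LatticeQCDFlow.Exactness

open MeasureTheory Matrix Topology
open Literature.LinearAlgebra.Matrix
open Literature.MathematicalPhysics.QuantumFieldTheory
open scoped ENNReal

variable {n : Type*} [Fintype n] [DecidableEq n]

omit [Fintype n] [DecidableEq n] in
/-- A jointly continuous family of eigenvalue maps is continuous on the torus slice by slice. -/
theorem continuousOn_slice_of_jointly {Y : Type*} [TopologicalSpace Y] {f : Y → (n → ℂ) → (n → ℂ)}
    (hf : ContinuousOn (fun q : Y × (n → ℂ) => f q.1 q.2) {q | ∀ i, ‖q.2 i‖ = 1}) (y : Y) :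
    ContinuousOn (f y) {d | ∀ i, ‖d i‖ = 1} :=
  hf.comp (Continuous.prodMk_right y).continuousOn fun _ hd => hd

/-- A jointly continuous real density is Borel measurable slice by slice, after `ofReal`. -/
theorem measurable_ofReal_slice {Y G : Type*} [TopologicalSpace Y] [TopologicalSpace G]
    [MeasurableSpace G] [OpensMeasurableSpace G] {j : Y → G → ℝ}
    (hjc : Continuous fun q : Y × G => j q.1 q.2) (y : Y) :
    Measurable fun g => ENNReal.ofReal (j y g) :=
  ENNReal.measurable_ofReal.comp (hjc.comp (Continuous.prodMk_right y)).measurable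

/-- **END TO END (`SU(n)`): the spectral coupling layer is exact for product Haar with the booked
density, given Weyl's formula and the torus Jacobians.** -/
theorem hasJacobian_spectralCouplingLayer_of_weyl_specialUnitary {ι : Type*} [Fintype ι]
    (hW : Measure.map (fun q : Matrix.specialUnitaryGroup n ℂ × specialDiagonalTorus n =>
        q.1 * (q.2 : Matrix.specialUnitaryGroup n ℂ) * q.1⁻¹)
      ((haarProbability (Matrix.specialUnitaryGroup n ℂ)).prod
        ((haarProbability (specialDiagonalTorus n)).withDensity fun t => ENNReal.ofReal
          ((∏ i, ∏ k ∈ Finset.univ.erase i,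
            ‖((t : Matrix.specialUnitaryGroup n ℂ) : Matrix n n ℂ) i i -
              ((t : Matrix.specialUnitaryGroup n ℂ) : Matrix n n ℂ) k k‖) / (Fintype.card n).factorial))) =
      haarProbability (Matrix.specialUnitaryGroup n ℂ))
    (p : ι → Prop) [DecidablePred p]
    (S : {i // p i} → ({i // ¬p i} → Matrix.specialUnitaryGroup n ℂ) → Matrix.specialUnitaryGroup n ℂ)
    (hS : ∀ a, Continuous (S a))
    (f : {i // p i} → ({i // ¬p i} → Matrix.specialUnitaryGroup n ℂ) → (n → ℂ) → (n → ℂ))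
    (hf : ∀ a, ContinuousOn
      (fun q : ({i // ¬p i} → Matrix.specialUnitaryGroup n ℂ) × (n → ℂ) => f a q.1 q.2)
      {q | ∀ i, ‖q.2 i‖ = 1})
    (h : {i // p i} → ({i // ¬p i} → Matrix.specialUnitaryGroup n ℂ) →
      Matrix.specialUnitaryGroup n ℂ → Matrix.specialUnitaryGroup n ℂ)
    (hagree : ∀ a y (P : Matrix.specialUnitaryGroup n ℂ) (V : Matrix n n ℂ) (d : n → ℂ),
      V ∈ Matrix.unitaryGroup n ℂ → (P : Matrix n n ℂ) = V * diagonal d * star V →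
        ((h a y P : Matrix.specialUnitaryGroup n ℂ) : Matrix n n ℂ) = V * diagonal (f a y d) * star V)
    (fT : {i // p i} → ({i // ¬p i} → Matrix.specialUnitaryGroup n ℂ) →
      specialDiagonalTorus n → specialDiagonalTorus n)
    (hfT : ∀ a y (t : specialDiagonalTorus n),
      ((fT a y t : Matrix.specialUnitaryGroup n ℂ) : Matrix n n ℂ) =
        diagonal (f a y fun i => ((t : Matrix.specialUnitaryGroup n ℂ) : Matrix n n ℂ) i i))
    (JfT : {i // p i} → ({i // ¬p i} → Matrix.specialUnitaryGroup n ℂ) → specialDiagonalTorus n → ℝ≥0∞)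
    (hfJ : ∀ a y, HasJacobian (haarProbability (specialDiagonalTorus n)) (fT a y) (JfT a y))
    (j : {i // p i} → ({i // ¬p i} → Matrix.specialUnitaryGroup n ℂ) → Matrix.specialUnitaryGroup n ℂ → ℝ)
    (hjc : ∀ a, Continuous
      fun q : ({i // ¬p i} → Matrix.specialUnitaryGroup n ℂ) × Matrix.specialUnitaryGroup n ℂ =>
        j a q.1 q.2)
    (hj0 : ∀ a y g, 0 ≤ j a y g)
    (hJ : ∀ a y (g : Matrix.specialUnitaryGroup n ℂ) (t : specialDiagonalTorus n),
      ENNReal.ofReal (j a y (g * (t : Matrix.specialUnitaryGroup n ℂ) * g⁻¹)) * ENNReal.ofReal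
          ((∏ i, ∏ k ∈ Finset.univ.erase i,
            ‖((t : Matrix.specialUnitaryGroup n ℂ) : Matrix n n ℂ) i i -
              ((t : Matrix.specialUnitaryGroup n ℂ) : Matrix n n ℂ) k k‖) / (Fintype.card n).factorial) =
        JfT a y t * ENNReal.ofReal
          ((∏ i, ∏ k ∈ Finset.univ.erase i,
            ‖((fT a y t : Matrix.specialUnitaryGroup n ℂ) : Matrix n n ℂ) i i -
              ((fT a y t : Matrix.specialUnitaryGroup n ℂ) : Matrix n n ℂ) k k‖) / (Fintype.card n).factorial)) :
    HasJacobian (Measure.pi fun _ : ι => haarProbability (Matrix.specialUnitaryGroup n ℂ))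
      (Theory2.coupleFun p fun a y u => h a y (u * S a y) * (u * S a y)⁻¹ * u)
      fun U => ENNReal.ofReal (Theory2.coupleJac p (fun a y u => j a y (u * S a y)) U) :=
  hasJacobian_spectralCouplingLayer_of_kernelJacobian p S hS f hf h hagree j hjc
    (fun a y => hasJacobian_spectralKernel_specialUnitaryGroup_of_weyl hW
      (continuousOn_slice_of_jointly (hf a) y) (hagree a y) (hfT a y) (hfJ a y)
      (measurable_ofReal_slice (hjc a) y) (hJ a y))
    hj0

/-- **END TO END (`U(n)`): the spectral coupling layer is exact for product Haar with the booked
density, given Weyl's formula and the torus Jacobians.** -/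
theorem hasJacobian_spectralCouplingLayer_of_weyl_unitary {ι : Type*} [Fintype ι]
    (hW : Measure.map (fun q : Matrix.unitaryGroup n ℂ × diagonalTorus n =>
        q.1 * (q.2 : Matrix.unitaryGroup n ℂ) * q.1⁻¹)
      ((haarProbability (Matrix.unitaryGroup n ℂ)).prod
        ((haarProbability (diagonalTorus n)).withDensity fun t => ENNReal.ofReal
          ((∏ i, ∏ k ∈ Finset.univ.erase i,
            ‖((t : Matrix.unitaryGroup n ℂ) : Matrix n n ℂ) i i -
              ((t : Matrix.unitaryGroup n ℂ) : Matrix n n ℂ) k k‖) / (Fintype.card n).factorial))) =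
      haarProbability (Matrix.unitaryGroup n ℂ))
    (p : ι → Prop) [DecidablePred p]
    (S : {i // p i} → ({i // ¬p i} → Matrix.unitaryGroup n ℂ) → Matrix.unitaryGroup n ℂ)
    (hS : ∀ a, Continuous (S a))
    (f : {i // p i} → ({i // ¬p i} → Matrix.unitaryGroup n ℂ) → (n → ℂ) → (n → ℂ))
    (hf : ∀ a, ContinuousOn
      (fun q : ({i // ¬p i} → Matrix.unitaryGroup n ℂ) × (n → ℂ) => f a q.1 q.2)
      {q | ∀ i, ‖q.2 i‖ = 1})
    (h : {i // p i} → ({i // ¬p i} → Matrix.unitaryGroup n ℂ) →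
      Matrix.unitaryGroup n ℂ → Matrix.unitaryGroup n ℂ)
    (hagree : ∀ a y (P : Matrix.unitaryGroup n ℂ) (V : Matrix n n ℂ) (d : n → ℂ),
      V ∈ Matrix.unitaryGroup n ℂ → (P : Matrix n n ℂ) = V * diagonal d * star V →
        ((h a y P : Matrix.unitaryGroup n ℂ) : Matrix n n ℂ) = V * diagonal (f a y d) * star V)
    (fT : {i // p i} → ({i // ¬p i} → Matrix.unitaryGroup n ℂ) → diagonalTorus n → diagonalTorus n)
    (hfT : ∀ a y (t : diagonalTorus n),
      ((fT a y t : Matrix.unitaryGroup n ℂ) : Matrix n n ℂ) =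
        diagonal (f a y fun i => ((t : Matrix.unitaryGroup n ℂ) : Matrix n n ℂ) i i))
    (JfT : {i // p i} → ({i // ¬p i} → Matrix.unitaryGroup n ℂ) → diagonalTorus n → ℝ≥0∞)
    (hfJ : ∀ a y, HasJacobian (haarProbability (diagonalTorus n)) (fT a y) (JfT a y))
    (j : {i // p i} → ({i // ¬p i} → Matrix.unitaryGroup n ℂ) → Matrix.unitaryGroup n ℂ → ℝ)
    (hjc : ∀ a, Continuous
      fun q : ({i // ¬p i} → Matrix.unitaryGroup n ℂ) × Matrix.unitaryGroup n ℂ => j a q.1 q.2)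
    (hj0 : ∀ a y g, 0 ≤ j a y g)
    (hJ : ∀ a y (g : Matrix.unitaryGroup n ℂ) (t : diagonalTorus n),
      ENNReal.ofReal (j a y (g * (t : Matrix.unitaryGroup n ℂ) * g⁻¹)) * ENNReal.ofReal
          ((∏ i, ∏ k ∈ Finset.univ.erase i,
            ‖((t : Matrix.unitaryGroup n ℂ) : Matrix n n ℂ) i i -
              ((t : Matrix.unitaryGroup n ℂ) : Matrix n n ℂ) k k‖) / (Fintype.card n).factorial) =
        JfT a y t * ENNReal.ofReal
          ((∏ i, ∏ k ∈ Finset.univ.erase i,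
            ‖((fT a y t : Matrix.unitaryGroup n ℂ) : Matrix n n ℂ) i i -
              ((fT a y t : Matrix.unitaryGroup n ℂ) : Matrix n n ℂ) k k‖) / (Fintype.card n).factorial)) :
    HasJacobian (Measure.pi fun _ : ι => haarProbability (Matrix.unitaryGroup n ℂ))
      (Theory2.coupleFun p fun a y u => h a y (u * S a y) * (u * S a y)⁻¹ * u)
      fun U => ENNReal.ofReal (Theory2.coupleJac p (fun a y u => j a y (u * S a y)) U) :=
  haveI : SecondCountableTopology (Matrix.unitaryGroup n ℂ) := secondCountableTopology_unitaryGroup n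
  hasJacobian_spectralCouplingLayer_of_kernelJacobian_unitary p S hS f hf h hagree j hjc
    (fun a y => hasJacobian_spectralKernel_unitaryGroup_of_weyl hW
      (continuousOn_slice_of_jointly (hf a) y) (hagree a y) (hfT a y) (hfJ a y)
      (measurable_ofReal_slice (hjc a) y) (hJ a y))
    hj0

end Summit.Ventures.LatticeQCDFlow.Exactness
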